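/-
Copyright (c) 2026 the pub-hodgecm-mathlib formalisation cell (harness21).  Prover seat hodgecm-mathlib-K2Liu-p11 (g2), Track B «K2-LIT»,
#184♮ = hLiu418 = `stmt-HodgeConjecture-24832`; LEAD F0P6-plan (g13) 10:13:40Z (Q2)(Q3)(B) «the explicit Lie derivative
`Y • f⁰_{s,k} = λ_k(s) · f_{s,τ′}` for `Y ∈ 𝔭^±` in tube coordinates; arbitrary `C¹` curve, ambient derivative of the explicit
real-analytic `archScalarSection`» (row `K2LiuArchIntertwiningLieEquivariance` = (A) K2E5-p16 + (B) this lineage), FILE 1 of 2: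
the MASTER FORMULA.  THEOREMS ONLY (no `def`, no `instance`, no notation, no named-fact hypothesis, no `sorry`; no matrix norm in any statement).
-/
import Summits.HodgeConjecture.HodgeConjecture.Theorems.K2LiuArchInducedTubeDefs     -- ★ (this lineage) (D∞): `archScalarSection`
import Summits.HodgeConjecture.HodgeConjecture.Theorems.K2LiuHermitianTubeDescend    -- ★ (this lineage) E-3: Jacobi `hasDerivAt_det_comp_of_eq_one`
import Mathlib.Analysis.SpecialFunctions.Pow.Deriv
import Mathlib.Analysis.SpecialFunctions.Sqrt
import Mathlib.Analysis.InnerProductSpace.Calculus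
import Mathlib.Analysis.Complex.RealDeriv
import Mathlib.Analysis.Calculus.Deriv.Pi
import Mathlib.Analysis.Matrix.Normed
import HarnessLib

/-!
# Crux `HLiu418`, A∞ organ: the derivative of the scalar-type vector `f⁰_{s,k}` along a right curve — the MASTER FORMULA

Cell `hodgecm-mathlib`, crux item hLiu418 = `stmt-HodgeConjecture-24832` (helper lane `--supports`, count-neutral).

Frame of record (★ H1-A∕B∕C, ★ (D∞)): `U(J)`, base point `i·1`, `Δ_g = denom g (i1) = g₂₁·i + g₂₂`, `j(g, i1) = det Δ_g`,
`f⁰_{s,k}(g) = archScalarSection k s g = j^{−k} · ‖j‖^{k − 2s − l}`.  Letters of 𝔲(J) (★ H1-E, ★ `K2LiuHermitianTubeFramePMinus`):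
`μ b = (b 0; 0 −b)`, `σ b = (0 b; b 0)`, `κ b = (0 b; −b 0)`; the tube `𝔭⁻ = {μ b − i σ b} = {(b, −ib; −ib, −b)}`, `𝔭⁺ = {μ b + i σ b}`.
The Lie derivative of a function on the REAL group along `Y ∈ 𝔲(J)` is `D_Y f(g) = d∕dt|₀ f(g γ_t)` for any `C¹` curve `γ` with `γ 0 = 1`,
`γ′(0) = Y` (e.g. `exp (tY)`); a complex element `Y₁ + iY₂ ∈ 𝔤_ℂ` acts by `D_{Y₁} + i D_{Y₂}`.  (The ambient derivative of the real-analytic,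
NON-holomorphic `f⁰` along the complex matrix direction `μ b − iσ b` is NOT this action: it vanishes identically, §1 `denom_mul_pMinus`;
the `𝔤_ℂ`-action is assembled from the real letters in FILE 2 `K2LiuArchScalarSectionPDerivative`.)

* §1 algebra of `W ↦ denom (g W) (i1)` (linear; `= 0` on `𝔭⁻(b)`, `= −2·denom g (−i1)·b` on `𝔭⁺(b)`, `= −i·Δ_g b` on `κ b`);
* §2 JACOBI along a right curve: `d∕dt|₀ det Δ_{g γ_t} = det Δ_g · tr(Δ_g⁻¹ · denom (g W) (i1))` (★ E-3 `hasDerivAt_det_comp_of_eq_one`);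
* §3 THE MASTER FORMULA (generic rank, any direction `W ∈ M_{2l}(ℂ)`, any entrywise-`C¹` curve `γ`, any `g` with `det Δ_g ≠ 0`):
  `d∕dt|₀ f⁰_{s,k}(g γ_t) = f⁰_{s,k}(g) · ((m∕2 − k)·τ + (m∕2)·conj τ)`, `m = k − 2s − l`, `τ = tr(Δ_g⁻¹ · denom (g W) (i1))`
  (`hasDerivAt_archScalarSection_mul_curve`; instances `γ_t = exp (tW)` — the curve of record of ★ H1-E — and `γ_t = 1 + tW`).
References: [Shimura1997, §§5–6, §16.4]; [Knapp1986, Ch. VI §2]; [Bump1997, §2.1] (the `SL₂(ℝ)` prototype `R, L` operators on `y^s`).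
HONEST LABEL: HC_CM is proved only modulo the 7 printed citations (2 remaining named inputs: hLiu418 = stmt-HodgeConjecture-24832,
h413 = stmt-HodgeConjecture-24833) until rung 0 closes; count-neutral helper, closes no socket.
-/

set_option autoImplicit false
set_option linter.dupNamespace false

noncomputable section

open Complex Matrix Filter NormedSpace
open scoped ComplexConjugate Topology RealInnerProductSpace

namespace Summit.HodgeConjecture.HodgeConjecture.Cruxes.HLiu418.K2LiuArchScalarSectionCurveDerivative

open Literature.NumberTheory.ModularForms.SiegelUpperHalfSpace (num denom num_def denom_def num_fromBlocks denom_fromBlocks denom_mul)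
open Summit.HodgeConjecture.HodgeConjecture.Cruxes.HLiu418.K2LiuArchInducedTubeDefs
open Summit.HodgeConjecture.HodgeConjecture.Cruxes.HLiu418.K2LiuHermitianTubeDescend (hasDerivAt_det_comp_of_eq_one)

variable {l : Type*} [Fintype l] [DecidableEq l]

/-! ## §1  Algebra of `W ↦ denom (g W) (i1)` -/

omit [Fintype l] [DecidableEq l] in
/-- `denom` is additive in the matrix. [folklore] -/
theorem denom_add {l : Type*} [Fintype l] (P Q : Matrix (l ⊕ l) (l ⊕ l) ℂ) (Z : Matrix l l ℂ) :
    denom (P + Q) Z = denom P Z + denom Q Z := by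
  have h21 : (P + Q).toBlocks₂₁ = P.toBlocks₂₁ + Q.toBlocks₂₁ := rfl
  have h22 : (P + Q).toBlocks₂₂ = P.toBlocks₂₂ + Q.toBlocks₂₂ := rfl
  rw [denom_def, denom_def, denom_def, h21, h22, Matrix.add_mul]
  abel

omit [Fintype l] [DecidableEq l] in
/-- `denom` is homogeneous in the matrix (any scalars acting compatibly on `ℂ`, e.g. `ℝ` or `ℂ`). [folklore] -/
theorem denom_smul {l : Type*} [Fintype l] {R : Type*} [Monoid R] [DistribMulAction R ℂ] [IsScalarTower R ℂ ℂ]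
    (r : R) (P : Matrix (l ⊕ l) (l ⊕ l) ℂ) (Z : Matrix l l ℂ) :
    denom (r • P) Z = r • denom P Z := by
  have h21 : (r • P).toBlocks₂₁ = r • P.toBlocks₂₁ := rfl
  have h22 : (r • P).toBlocks₂₂ = r • P.toBlocks₂₂ := rfl
  rw [denom_def, denom_def, h21, h22, Matrix.smul_mul, smul_add]

omit [Fintype l] [DecidableEq l] in
/-- `denom` of a negative. [folklore] -/
theorem denom_neg {l : Type*} [Fintype l] (P : Matrix (l ⊕ l) (l ⊕ l) ℂ) (Z : Matrix l l ℂ) :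
    denom (-P) Z = -denom P Z := by
  have h21 : (-P).toBlocks₂₁ = -P.toBlocks₂₁ := rfl
  have h22 : (-P).toBlocks₂₂ = -P.toBlocks₂₂ := rfl
  rw [denom_def, denom_def, h21, h22, Matrix.neg_mul, neg_add]

omit [Fintype l] [DecidableEq l] in
/-- `denom` of a difference. [folklore] -/
theorem denom_sub {l : Type*} [Fintype l] (P Q : Matrix (l ⊕ l) (l ⊕ l) ℂ) (Z : Matrix l l ℂ) :
    denom (P - Q) Z = denom P Z - denom Q Z := by
  rw [sub_eq_add_neg, denom_add, denom_neg, ← sub_eq_add_neg]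

omit [DecidableEq l] in
/-- The linear letter `W ↦ denom (g W) (i1)` is additive. [folklore] -/
theorem denom_mul_add (g W W' : Matrix (l ⊕ l) (l ⊕ l) ℂ) (Z : Matrix l l ℂ) :
    denom (g * (W + W')) Z = denom (g * W) Z + denom (g * W') Z := by
  rw [Matrix.mul_add, denom_add]

omit [DecidableEq l] in
/-- The linear letter `W ↦ denom (g W) (i1)` is `ℂ`-homogeneous. [folklore] -/
theorem denom_mul_smul (g : Matrix (l ⊕ l) (l ⊕ l) ℂ) (c : ℂ) (W : Matrix (l ⊕ l) (l ⊕ l) ℂ) (Z : Matrix l l ℂ) :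
    denom (g * (c • W)) Z = c • denom (g * W) Z := by
  rw [Matrix.mul_smul, denom_smul]

omit [Fintype l] [DecidableEq l] in
/-- `𝔭⁻(b) = μ b − i σ b = (b, −ib; −ib, −b)` in blocks. [Knapp1986, Ch. VI §2] -/
theorem pMinus_eq (b : Matrix l l ℂ) :
    (fromBlocks b 0 0 (-b) : Matrix (l ⊕ l) (l ⊕ l) ℂ) - I • fromBlocks 0 b b 0 = fromBlocks b (-(I • b)) (-(I • b)) (-b) := by
  simp only [fromBlocks_smul, sub_eq_add_neg, fromBlocks_neg, fromBlocks_add, smul_zero, neg_zero, add_zero, zero_add]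

omit [Fintype l] [DecidableEq l] in
/-- `𝔭⁺(b) = μ b + i σ b = (b, ib; ib, −b)` in blocks. [Knapp1986, Ch. VI §2] -/
theorem pPlus_eq (b : Matrix l l ℂ) :
    (fromBlocks b 0 0 (-b) : Matrix (l ⊕ l) (l ⊕ l) ℂ) + I • fromBlocks 0 b b 0 = fromBlocks b (I • b) (I • b) (-b) := by
  simp only [fromBlocks_smul, fromBlocks_add, smul_zero, add_zero, zero_add]

/-- **THE TUBE `𝔭⁻` IS INVISIBLE TO `denom (· ) (i1)` TO FIRST ORDER**: `denom (g · 𝔭⁻(b)) (i1) = 0` for every `g`.  (So the AMBIENT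
derivative of `f⁰_{s,k}` along the complex matrix direction `𝔭⁻(b)` vanishes — which is why the `𝔤_ℂ`-action must be built from the real
letters `μ b`, `σ b`, §4.) [Shimura1997, §6] -/
theorem denom_mul_pMinus (g : Matrix (l ⊕ l) (l ⊕ l) ℂ) (b : Matrix l l ℂ) :
    denom (g * fromBlocks b (-(I • b)) (-(I • b)) (-b)) (I • (1 : Matrix l l ℂ)) = 0 := by
  rw [denom_mul, num_fromBlocks, denom_fromBlocks]
  have h1 : b * (I • (1 : Matrix l l ℂ)) + -(I • b) = 0 := by rw [Matrix.mul_smul, Matrix.mul_one, add_neg_cancel]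
  have h2 : -(I • b) * (I • (1 : Matrix l l ℂ)) + -b = 0 := by
    rw [Matrix.mul_smul, Matrix.mul_one, smul_neg, smul_smul, I_mul_I, neg_smul, one_smul, neg_neg, add_neg_cancel]
  rw [h1, h2, Matrix.mul_zero, Matrix.mul_zero, add_zero]

/-- The same for the letter `μ b − i σ b`. [Shimura1997, §6] -/
theorem denom_mul_mu_sub_I_smul_sigma (g : Matrix (l ⊕ l) (l ⊕ l) ℂ) (b : Matrix l l ℂ) :
    denom (g * ((fromBlocks b 0 0 (-b) : Matrix (l ⊕ l) (l ⊕ l) ℂ) - I • fromBlocks 0 b b 0)) (I • (1 : Matrix l l ℂ)) = 0 := by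
  rw [pMinus_eq, denom_mul_pMinus]

/-- The block letter `i·g₂₁ − g₂₂ = −denom g (−i1)`. [folklore] -/
theorem I_smul_toBlocks₂₁_sub (g : Matrix (l ⊕ l) (l ⊕ l) ℂ) :
    I • g.toBlocks₂₁ - g.toBlocks₂₂ = -denom g (-(I • (1 : Matrix l l ℂ))) := by
  rw [denom_def, Matrix.mul_neg, Matrix.mul_smul, Matrix.mul_one, neg_add, neg_neg, sub_eq_add_neg]

/-- **`denom (g · 𝔭⁺(b)) (i1) = −2 · denom g (−i1) · b`**. [Shimura1997, §6] -/
theorem denom_mul_pPlus (g : Matrix (l ⊕ l) (l ⊕ l) ℂ) (b : Matrix l l ℂ) :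
    denom (g * fromBlocks b (I • b) (I • b) (-b)) (I • (1 : Matrix l l ℂ)) = -((2 : ℂ) • (denom g (-(I • (1 : Matrix l l ℂ))) * b)) := by
  rw [denom_mul, num_fromBlocks, denom_fromBlocks]
  have h1 : b * (I • (1 : Matrix l l ℂ)) + I • b = (2 * I) • b := by rw [Matrix.mul_smul, Matrix.mul_one, mul_smul, two_smul]
  have h2 : I • b * (I • (1 : Matrix l l ℂ)) + -b = -((2 : ℂ) • b) := by
    rw [Matrix.mul_smul, Matrix.mul_one, smul_smul, I_mul_I, neg_smul, one_smul, two_smul, neg_add]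
  rw [h1, h2, ← neg_neg (denom g (-(I • (1 : Matrix l l ℂ)))), ← I_smul_toBlocks₂₁_sub, Matrix.mul_smul, Matrix.mul_neg,
    Matrix.mul_smul, Matrix.neg_mul, Matrix.sub_mul, Matrix.smul_mul]
  module

/-- The same for the letter `μ b + i σ b`. [Shimura1997, §6] -/
theorem denom_mul_mu_add_I_smul_sigma (g : Matrix (l ⊕ l) (l ⊕ l) ℂ) (b : Matrix l l ℂ) :
    denom (g * ((fromBlocks b 0 0 (-b) : Matrix (l ⊕ l) (l ⊕ l) ℂ) + I • fromBlocks 0 b b 0)) (I • (1 : Matrix l l ℂ)) =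
      -((2 : ℂ) • (denom g (-(I • (1 : Matrix l l ℂ))) * b)) := by
  rw [pPlus_eq, denom_mul_pPlus]

/-- **`denom (g · κ(b)) (i1) = −i · Δ_g · b`** for the compact letter `κ b = (0 b; −b 0)`. [Shimura1997, §6] -/
theorem denom_mul_kappa (g : Matrix (l ⊕ l) (l ⊕ l) ℂ) (b : Matrix l l ℂ) :
    denom (g * fromBlocks 0 b (-b) 0) (I • (1 : Matrix l l ℂ)) = -(I • (denom g (I • (1 : Matrix l l ℂ)) * b)) := by
  rw [denom_mul, num_fromBlocks, denom_fromBlocks, denom_def, Matrix.zero_mul, zero_add, add_zero, Matrix.neg_mul, Matrix.mul_smul,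
    Matrix.mul_one, Matrix.mul_neg, Matrix.mul_smul, Matrix.add_mul, Matrix.mul_smul, Matrix.mul_one, Matrix.smul_mul, smul_add,
    smul_smul, I_mul_I]
  module

/-! ## §2  Jacobi along a right curve -/

/-- **JACOBI ALONG A RIGHT CURVE.**  If `γ` is an entrywise-`C¹` curve in `M_{2l}(ℂ)` with `γ 0 = 1` and velocity `W` at `0`, and
`det Δ_g ≠ 0`, then `t ↦ j(g γ_t, i1) = det (denom (g γ_t) (i1))` has derivative `det Δ_g · tr(Δ_g⁻¹ · denom (g W) (i1))` at `0`.
[Shimura1997, §5.6] -/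
theorem hasDerivAt_det_denom_mul_curve {g W : Matrix (l ⊕ l) (l ⊕ l) ℂ} (hg : (denom g (I • (1 : Matrix l l ℂ))).det ≠ 0)
    {γ : ℝ → Matrix (l ⊕ l) (l ⊕ l) ℂ} (hγ0 : γ 0 = 1) (hγ : ∀ i j, HasDerivAt (fun t => γ t i j) (W i j) 0) :
    HasDerivAt (fun t : ℝ => (denom (g * γ t) (I • (1 : Matrix l l ℂ))).det)
      ((denom g (I • (1 : Matrix l l ℂ))).det *
        ((denom g (I • (1 : Matrix l l ℂ)))⁻¹ * denom (g * W) (I • (1 : Matrix l l ℂ))).trace) 0 := by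
  open scoped Matrix.Norms.Elementwise in
  set Δ : Matrix l l ℂ := denom g (I • (1 : Matrix l l ℂ)) with hΔ
  have hΔu : IsUnit Δ.det := isUnit_iff_ne_zero.mpr hg
  -- the curve in the (elementwise = Pi) norm
  have hγ' : HasDerivAt γ W 0 := hasDerivAt_pi.2 fun i => hasDerivAt_pi.2 fun j => hγ i j
  -- the ℝ-linear letter `M ↦ Δ⁻¹ · denom (g M) (i1)`
  let Lₗ : Matrix (l ⊕ l) (l ⊕ l) ℂ →ₗ[ℝ] Matrix l l ℂ :=
    { toFun := fun M => Δ⁻¹ * denom (g * M) (I • (1 : Matrix l l ℂ))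
      map_add' := fun M M' => by simp only [Matrix.mul_add, denom_add]
      map_smul' := fun r M => by simp only [Matrix.mul_smul, denom_smul, RingHom.id_apply] }
  let L : Matrix (l ⊕ l) (l ⊕ l) ℂ →L[ℝ] Matrix l l ℂ := LinearMap.toContinuousLinearMap Lₗ
  have hLapply : ∀ M, L M = Δ⁻¹ * denom (g * M) (I • (1 : Matrix l l ℂ)) := fun M => rfl
  have hL : HasDerivAt (fun t : ℝ => L (γ t)) (L W) 0 := L.hasFDerivAt.comp_hasDerivAt 0 hγ'
  simp only [hLapply] at hL
  -- as a coordinate curve through `1`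
  have hc : HasDerivAt (fun t : ℝ => fun i j => (Δ⁻¹ * denom (g * γ t) (I • (1 : Matrix l l ℂ))) i j)
      (fun i j => (Δ⁻¹ * denom (g * W) (I • (1 : Matrix l l ℂ))) i j) 0 := hL
  have hc0 : (fun i j => (Δ⁻¹ * denom (g * γ 0) (I • (1 : Matrix l l ℂ))) i j) = fun i j => (1 : Matrix l l ℂ) i j := by
    rw [hγ0, Matrix.mul_one, Matrix.nonsing_inv_mul _ hΔu]
  have hdet := hasDerivAt_det_comp_of_eq_one hc hc0
  have hof : ∀ M : Matrix l l ℂ, Matrix.of (fun i j => M i j) = M := fun M => rfl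
  simp only [hof] at hdet
  -- `det (denom (g γ_t)) = det Δ · det (Δ⁻¹ · denom (g γ_t))`
  have hfac : ∀ t : ℝ, (denom (g * γ t) (I • (1 : Matrix l l ℂ))).det =
      Δ.det * (Δ⁻¹ * denom (g * γ t) (I • (1 : Matrix l l ℂ))).det := by
    intro t
    rw [← det_mul, ← Matrix.mul_assoc, Matrix.mul_nonsing_inv _ hΔu, Matrix.one_mul]
  have h := hdet.const_mul Δ.det
  simp only [← hfac] at h
  exact h

/-! ## §3  The master formula -/

/-- The scalar bookkeeping behind the master formula: with `A = δ₀^{−k}`, `B = n^m`, `n = ‖δ₀‖`,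
`(−k)·(A δ₀⁻¹)·(δ₀ τ)·B + A·(m·(B∕n)·(n·(τ+conj τ)∕2)) = A·B·((m∕2 − k)τ + (m∕2) conj τ)`. [folklore] -/
theorem master_algebra (A B δ₀ n τ τc m kc : ℂ) (hδ₀ : δ₀ ≠ 0) (hn : n ≠ 0) :
    -kc * (A * δ₀⁻¹) * (δ₀ * τ) * B + A * (m * (B / n) * (n * ((τ + τc) / 2))) =
      A * B * ((m / 2 - kc) * τ + m / 2 * τc) := by
  field_simp
  ring

/-- **THE MASTER FORMULA** (generic rank `l`, any direction `W ∈ M_{2l}(ℂ)`, any entrywise-`C¹` curve `γ` through `1` with velocity `W`,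
any `g` with `j(g, i1) ≠ 0`):
`d∕dt|₀ f⁰_{s,k}(g γ_t) = f⁰_{s,k}(g) · ((m∕2 − k)·τ + (m∕2)·conj τ)`, `m = k − 2s − l`, `τ = tr(Δ_g⁻¹ · denom (g W) (i1))`.
(`f⁰ = j^{−k}‖j‖^m`; `d log j = τ dt`, `d log ‖j‖ = re τ dt`.) [Shimura1997, §16.4; Bump1997, §2.1] -/
theorem hasDerivAt_archScalarSection_mul_curve (k : ℤ) (s : ℂ) {g W : Matrix (l ⊕ l) (l ⊕ l) ℂ}
    (hg : (denom g (I • (1 : Matrix l l ℂ))).det ≠ 0)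
    {γ : ℝ → Matrix (l ⊕ l) (l ⊕ l) ℂ} (hγ0 : γ 0 = 1) (hγ : ∀ i j, HasDerivAt (fun t => γ t i j) (W i j) 0) :
    HasDerivAt (fun t : ℝ => archScalarSection k s (g * γ t))
      (archScalarSection k s g *
        ((((k : ℂ) - 2 * s - (Fintype.card l : ℂ)) / 2 - k) *
            ((denom g (I • (1 : Matrix l l ℂ)))⁻¹ * denom (g * W) (I • (1 : Matrix l l ℂ))).trace +
          ((k : ℂ) - 2 * s - (Fintype.card l : ℂ)) / 2 *
            conj ((denom g (I • (1 : Matrix l l ℂ)))⁻¹ * denom (g * W) (I • (1 : Matrix l l ℂ))).trace)) 0 := by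
  set Δ : Matrix l l ℂ := denom g (I • (1 : Matrix l l ℂ)) with hΔ
  set τ : ℂ := (Δ⁻¹ * denom (g * W) (I • (1 : Matrix l l ℂ))).trace with hτ
  set m : ℂ := (k : ℂ) - 2 * s - (Fintype.card l : ℂ) with hm
  clear_value m
  set δ : ℝ → ℂ := fun t => (denom (g * γ t) (I • (1 : Matrix l l ℂ))).det with hδdef
  have hδ : HasDerivAt δ (Δ.det * τ) 0 := hasDerivAt_det_denom_mul_curve hg hγ0 hγ
  have hδ0 : δ 0 = Δ.det := by
    simp only [hδdef, hγ0, Matrix.mul_one, hΔ]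
  have hΔ0 : Δ.det ≠ 0 := hg
  have hn0 : ‖Δ.det‖ ≠ 0 := norm_ne_zero_iff.mpr hΔ0
  have hnpos : 0 < ‖Δ.det‖ := norm_pos_iff.mpr hΔ0
  have hnc0 : ((‖Δ.det‖ : ℝ) : ℂ) ≠ 0 := Complex.ofReal_ne_zero.mpr hn0
  -- (i) the `j^{−k}` factor
  have hz : HasDerivAt (fun t : ℝ => δ t ^ (-k)) ((((-k : ℤ) : ℂ)) * δ 0 ^ (-k - 1) * (Δ.det * τ)) 0 := by
    have h := hasDerivAt_zpow (-k) (δ 0) (Or.inl (by rw [hδ0]; exact hΔ0))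
    exact h.comp (0 : ℝ) hδ
  rw [hδ0] at hz
  -- (ii) the norm `‖j‖`
  have hnsq : HasDerivAt (fun t : ℝ => ‖δ t‖ ^ 2) (2 * ⟪δ 0, Δ.det * τ⟫) 0 := hδ.norm_sq
  rw [hδ0] at hnsq
  have hinner : ⟪Δ.det, Δ.det * τ⟫ = ‖Δ.det‖ ^ 2 * τ.re := by
    rw [Complex.inner, mul_right_comm, Complex.mul_conj, Complex.normSq_eq_norm_sq, Complex.re_ofReal_mul]
  rw [hinner] at hnsq
  have hsqrt : HasDerivAt (fun t : ℝ => Real.sqrt (‖δ t‖ ^ 2)) ((2 * (‖Δ.det‖ ^ 2 * τ.re)) / (2 * Real.sqrt (‖δ 0‖ ^ 2))) 0 :=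
    hnsq.sqrt (by rw [hδ0]; positivity)
  have hnorm : HasDerivAt (fun t : ℝ => ‖δ t‖) (‖Δ.det‖ * τ.re) 0 := by
    have h2 : (fun t : ℝ => Real.sqrt (‖δ t‖ ^ 2)) = fun t => ‖δ t‖ := funext fun t => Real.sqrt_sq (norm_nonneg _)
    rw [h2, hδ0, Real.sqrt_sq (norm_nonneg _)] at hsqrt
    convert hsqrt using 1
    field_simp
  -- (iii) the complex power `‖j‖^m`
  have hG : HasDerivAt (fun t : ℝ => (((‖δ t‖ : ℝ) : ℂ)) ^ m)
      (m * ((‖Δ.det‖ : ℝ) : ℂ) ^ (m - 1) * (((‖Δ.det‖ * τ.re : ℝ)) : ℂ)) 0 := by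
    have ho : HasDerivAt (fun t : ℝ => ((‖δ t‖ : ℝ) : ℂ)) (((‖Δ.det‖ * τ.re : ℝ)) : ℂ) 0 := hnorm.ofReal_comp
    have hslit : ((‖δ 0‖ : ℝ) : ℂ) ∈ Complex.slitPlane := by
      rw [hδ0]
      exact Complex.ofReal_mem_slitPlane.2 hnpos
    have hp := (hasDerivAt_id (((‖δ 0‖ : ℝ) : ℂ))).cpow_const (c := m) hslit
    simp only [id, mul_one] at hp
    have hcomp := HasDerivAt.comp (0 : ℝ) (h := fun t : ℝ => ((‖δ t‖ : ℝ) : ℂ)) hp ho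
    rw [hδ0] at hcomp
    exact hcomp
  -- (iv) the product
  have hprod := hz.mul hG
  have hfun : (fun t : ℝ => archScalarSection k s (g * γ t)) = fun t => δ t ^ (-k) * (((‖δ t‖ : ℝ) : ℂ)) ^ m := by
    funext t
    rw [archScalarSection_apply, hm]
  rw [hfun]
  refine hprod.congr_deriv ?_
  have hval : archScalarSection k s g = Δ.det ^ (-k) * (((‖Δ.det‖ : ℝ) : ℂ)) ^ m := by rw [archScalarSection_apply, hm]
  have hpow : (((‖Δ.det‖ : ℝ) : ℂ)) ^ (m - 1) = (((‖Δ.det‖ : ℝ) : ℂ)) ^ m / ((‖Δ.det‖ : ℝ) : ℂ) := by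
    rw [Complex.cpow_sub _ _ hnc0, Complex.cpow_one]
  rw [hδ0, hval, zpow_sub_one₀ hΔ0, hpow, Complex.ofReal_mul, Complex.re_eq_add_conj, Int.cast_neg]
  have key := master_algebra (Δ.det ^ (-k)) ((((‖Δ.det‖ : ℝ) : ℂ)) ^ m) Δ.det (((‖Δ.det‖ : ℝ) : ℂ)) τ (conj τ) m (k : ℂ)
    hΔ0 hnc0
  linear_combination key

/-- The entries of `t ↦ exp (t W)` have derivative `W` at `0` (the one-parameter curve of record of ★ H1-E). [Knapp1986, Ch. I §1] -/
theorem hasDerivAt_exp_smul_entry {m : Type*} [Fintype m] [DecidableEq m] (Y : Matrix m m ℂ) (i j : m) :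
    HasDerivAt (fun t : ℝ => exp (t • Y) i j) (Y i j) 0 := by
  open scoped Matrix.Norms.Operator in
  have he : HasDerivAt (fun t : ℝ => exp (t • Y)) Y 0 := by
    have h := hasDerivAt_exp_smul_const' (𝕂 := ℝ) Y 0
    rwa [zero_smul, NormedSpace.exp_zero, mul_one] at h
  exact (Matrix.entryLinearMap ℝ ℂ i j).toContinuousLinearMap.hasFDerivAt.comp_hasDerivAt 0 he

/-- `exp (0 · Y) = 1`. [folklore] -/
theorem exp_zero_smul_eq_one {m : Type*} [Fintype m] [DecidableEq m] (Y : Matrix m m ℂ) :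
    exp ((0 : ℝ) • Y) = 1 := by
  rw [zero_smul, NormedSpace.exp_zero]

/-- The entries of the affine curve `t ↦ 1 + t W` have derivative `W` at `0`. [folklore] -/
theorem hasDerivAt_one_add_smul_entry {m : Type*} (Y : Matrix m m ℂ) [DecidableEq m] (i j : m) :
    HasDerivAt (fun t : ℝ => ((1 : Matrix m m ℂ) + (t : ℂ) • Y) i j) (Y i j) 0 := by
  have h : HasDerivAt (fun t : ℝ => (1 : Matrix m m ℂ) i j + (t : ℂ) * Y i j) (0 + 1 * Y i j) 0 :=
    (hasDerivAt_const (0 : ℝ) _).add ((Complex.ofRealCLM.hasDerivAt).mul_const (Y i j))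
  rw [zero_add, one_mul] at h
  exact h.congr_of_eventuallyEq (Eventually.of_forall fun t => by simp [Matrix.add_apply, Matrix.smul_apply])

/-- **MASTER FORMULA ALONG `exp (tW)`** (any `W ∈ M_{2l}(ℂ)`; for `W ∈ 𝔲(J)` this is the Lie derivative `D_W f⁰_{s,k}(g)`).
[Shimura1997, §16.4; Bump1997, §2.1] -/
theorem hasDerivAt_archScalarSection_mul_exp (k : ℤ) (s : ℂ) {g : Matrix (l ⊕ l) (l ⊕ l) ℂ}
    (hg : (denom g (I • (1 : Matrix l l ℂ))).det ≠ 0) (W : Matrix (l ⊕ l) (l ⊕ l) ℂ) :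
    HasDerivAt (fun t : ℝ => archScalarSection k s (g * exp (t • W)))
      (archScalarSection k s g *
        ((((k : ℂ) - 2 * s - (Fintype.card l : ℂ)) / 2 - k) *
            ((denom g (I • (1 : Matrix l l ℂ)))⁻¹ * denom (g * W) (I • (1 : Matrix l l ℂ))).trace +
          ((k : ℂ) - 2 * s - (Fintype.card l : ℂ)) / 2 *
            conj ((denom g (I • (1 : Matrix l l ℂ)))⁻¹ * denom (g * W) (I • (1 : Matrix l l ℂ))).trace)) 0 :=
  hasDerivAt_archScalarSection_mul_curve k s hg (exp_zero_smul_eq_one W) (hasDerivAt_exp_smul_entry W)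

/-- **MASTER FORMULA ALONG THE AFFINE CURVE `1 + tW`** (K2E5-p16's ambient convention). [Shimura1997, §16.4] -/
theorem hasDerivAt_archScalarSection_mul_one_add_smul (k : ℤ) (s : ℂ) {g : Matrix (l ⊕ l) (l ⊕ l) ℂ}
    (hg : (denom g (I • (1 : Matrix l l ℂ))).det ≠ 0) (W : Matrix (l ⊕ l) (l ⊕ l) ℂ) :
    HasDerivAt (fun t : ℝ => archScalarSection k s (g * (1 + (t : ℂ) • W)))
      (archScalarSection k s g *
        ((((k : ℂ) - 2 * s - (Fintype.card l : ℂ)) / 2 - k) *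
            ((denom g (I • (1 : Matrix l l ℂ)))⁻¹ * denom (g * W) (I • (1 : Matrix l l ℂ))).trace +
          ((k : ℂ) - 2 * s - (Fintype.card l : ℂ)) / 2 *
            conj ((denom g (I • (1 : Matrix l l ℂ)))⁻¹ * denom (g * W) (I • (1 : Matrix l l ℂ))).trace)) 0 :=
  hasDerivAt_archScalarSection_mul_curve k s hg (by rw [Complex.ofReal_zero, zero_smul, add_zero])
    (hasDerivAt_one_add_smul_entry W)

end Summit.HodgeConjecture.HodgeConjecture.Cruxes.HLiu418.K2LiuArchScalarSectionCurveDerivative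

end
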